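import Literature.NumberTheory.Automorphic.ShimuraCurveCovolume
import Literature.NumberTheory.QuadraticForms.MeyerProofs
import HarnessLib

/-!
# Every positive rational number is a reduced norm from a division quaternion algebra over `ℚ`

Topic `NumberTheory/Automorphic`; theorems only (no definition, no named fact, no instance).
For a division quaternion algebra `B` over `ℚ` and a rational `n > 0` there is `x ∈ B` with
`nrd(x) = n` (`exists_reducedNorm_eq_of_pos`). This is the case `K = ℚ`, `n > 0` of the norm
theorem of Hasse–Schilling–Maass–Eichler (Vignéras, LNM 800, Ch. III §4 Thm. 4.1: `n(H^×)`
is the set of elements of `K^×` positive at the real places ramified in `H` — no condition for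
`n > 0`). Proof: the quinary rational form `trd(x x̄) - 2 n t² = 2 (nrd(x) - n t²)` on `B ⊕ ℚ`
is nondegenerate (the trace form of a quaternion algebra is nondegenerate,
`nondegenerate_trace_conj_of_isQuaternionAlgebra`) and indefinite (values `2` at `(1, 0)` and
`-2n` at `(0, 1)`), so it represents `0` by Meyer's theorem (tree
`Literature.NumberTheory.QuadraticForms.meyer_holds`, Serre IV §3.2 Cor. 2); in a zero
`(x, t) ≠ 0` one has `t ≠ 0` because `B` is a division algebra, and `nrd(x / t) = n`.

This is the norm input of the proof that the Eichler orders of an indefinite quaternion algebra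
over `ℚ` have class number one with generators of positive norm (Eichler), on the way to
`Literature.NumberTheory.Automorphic.ShimuraCurveData.volume_fd_eq`.

## References

* M.-F. Vignéras, *Arithmétique des algèbres de quaternions*, LNM 800 (1980), Ch. III §4
  Thm. 4.1 [VignerasLNM800].
* J.-P. Serre, *A Course in Arithmetic*, GTM 7 (1973), Ch. IV §3.2 Cor. 2 [Serre1973].
-/

open Matrix Finset

universe u

namespace Literature.NumberTheory.Automorphic

/-! ### Block-diagonal quadratic forms -/

section Blocks

variable {R : Type*} [CommRing R] {m m' : Type*} [Fintype m] [Fintype m'] [DecidableEq m]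
  [DecidableEq m']

/-- Reindexing a matrix reindexes its quadratic form. [folklore] -/
theorem toBilin'_reindex_self (e : m ≃ m') (M : Matrix m m R) (v : m' → R) :
    Matrix.toBilin' (Matrix.reindex e e M) v v = Matrix.toBilin' M (v ∘ e) (v ∘ e) := by
  rw [Matrix.toBilin'_apply, Matrix.toBilin'_apply, ← e.sum_comp]
  refine Finset.sum_congr rfl fun i _ => ?_
  rw [← e.sum_comp]
  refine Finset.sum_congr rfl fun j _ => ?_
  simp [Matrix.reindex_apply, Matrix.submatrix_apply]

/-- The quadratic form of a block-diagonal matrix is the sum of the two quadratic forms.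
[folklore] -/
theorem toBilin'_fromBlocks_diag (G : Matrix m m R) (D : Matrix m' m' R) (w : m ⊕ m' → R) :
    Matrix.toBilin' (Matrix.fromBlocks G 0 0 D) w w =
      (∑ a, ∑ a', w (Sum.inl a) * G a a' * w (Sum.inl a')) +
        ∑ b, ∑ b', w (Sum.inr b) * D b b' * w (Sum.inr b') := by
  rw [Matrix.toBilin'_apply, Fintype.sum_sum_type]
  simp_rw [Fintype.sum_sum_type]
  simp [Matrix.fromBlocks_apply₁₁, Matrix.fromBlocks_apply₁₂, Matrix.fromBlocks_apply₂₁,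
    Matrix.fromBlocks_apply₂₂]

end Blocks

/-! ### The norm theorem for positive rationals -/

variable {B : Type u} [Ring B] [Algebra ℚ B] [IsQuaternionAlgebra ℚ B]

/-- **The norm theorem over `ℚ`** (Vignéras III §4 Thm. 4.1 for `K = ℚ`): in a division
quaternion algebra `B` over `ℚ`, `nrd(x) = n` is solvable for every rational `n ≠ 0` which is
positive, or of either sign as soon as `nrd` takes a negative value on `B` (i.e. `B` is indefinite)
— Meyer's theorem for the quinary form `2 nrd(x) - 2 n t²`, indefinite in both cases.
[cite: VignerasLNM800, Ch. III §4 Thm. 4.1] -/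
theorem exists_reducedNorm_eq_of_pos_or_exists_neg (hdiv : ∀ x : B, x ≠ 0 → IsUnit x) {n : ℚ}
    (hn : n ≠ 0) (hsign : 0 < n ∨ ∃ x : B, reducedNorm ℚ B x < 0) :
    ∃ x : B, reducedNorm ℚ B x = n := by
  classical
  have h4 : Module.finrank ℚ B = 4 := IsQuaternionAlgebra.finrank_eq_four (K := ℚ) (D := B)
  haveI : Module.Finite ℚ B := Module.finite_of_finrank_pos (by omega)
  let b : Module.Basis (Fin 4) ℚ B := Module.finBasisOfFinrankEq ℚ B h4
  obtain ⟨T, hT⟩ := exists_bilinForm_trace_conj (B := B)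
  have hTnd := nondegenerate_trace_conj_of_isQuaternionAlgebra T hT
  set G : Matrix (Fin 4) (Fin 4) ℚ := LinearMap.BilinForm.toMatrix b T with hG
  have hGdet : G.det ≠ 0 := (LinearMap.BilinForm.nondegenerate_iff_det_ne_zero b).mp hTnd
  have hGapp : ∀ i j, G i j = T (b i) (b j) := fun i j => by
    rw [hG, LinearMap.BilinForm.toMatrix_apply]
  -- the value of the quaternary block: `∑ w_i G_ij w_j = T x x = 2 nrd x`
  have hquad : ∀ w : Fin 4 → ℚ, ∑ i', ∑ j', w i' * G i' j' * w j' =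
      2 * reducedNorm ℚ B (∑ i', w i' • b i') := by
    intro w
    have h1 : T (∑ i', w i' • b i') (∑ j', w j' • b j') = ∑ i', ∑ j', w i' * G i' j' * w j' := by
      rw [LinearMap.BilinForm.sum_left]
      refine Finset.sum_congr rfl fun i' _ => ?_
      rw [LinearMap.BilinForm.smul_left, LinearMap.BilinForm.sum_right, Finset.mul_sum]
      refine Finset.sum_congr rfl fun j' _ => ?_
      rw [LinearMap.BilinForm.smul_right, hGapp]
      ring
    rw [← h1, hT, reducedTrace_mul_standardInvolution_self]
  -- the quinary matrix `A = G ⊕ (-2n)`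
  set e : Fin 4 ⊕ Fin 1 ≃ Fin 5 := finSumFinEquiv with he
  set D : Matrix (Fin 1) (Fin 1) ℚ := (-2 * n) • (1 : Matrix (Fin 1) (Fin 1) ℚ) with hD
  set A : Matrix (Fin 5) (Fin 5) ℚ := Matrix.reindex e e (Matrix.fromBlocks G 0 0 D) with hA
  have hGsymm : G.IsSymm := by
    ext i j
    rw [Matrix.transpose_apply, hGapp, hGapp, hT, hT, reducedTrace_mul_standardInvolution_comm]
  have hDsymm : D.IsSymm := (Matrix.isSymm_one).smul _
  have hAsymm : A.IsSymm := by
    rw [hA]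
    exact (Matrix.IsSymm.fromBlocks hGsymm (by simp) hDsymm).submatrix _
  have hAdet : A.det ≠ 0 := by
    rw [hA, Matrix.det_reindex_self, Matrix.det_fromBlocks_zero₂₁, hD]
    refine mul_ne_zero hGdet ?_
    rw [Matrix.det_smul, Matrix.det_one, mul_one, Fintype.card_fin, pow_one]
    exact mul_ne_zero (by norm_num) hn
  have hAval : ∀ v : Fin 5 → ℚ, Matrix.toBilin' A v v =
      2 * reducedNorm ℚ B (∑ i', v (e (Sum.inl i')) • b i') + (-2 * n) * v (e (Sum.inr 0)) ^ 2 := by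
    intro v
    rw [hA, toBilin'_reindex_self, toBilin'_fromBlocks_diag, hquad]
    simp only [Function.comp_apply, Fin.sum_univ_one, hD, Matrix.smul_apply, Matrix.one_apply_eq,
      smul_eq_mul, mul_one]
    ring
  -- indefinite: values `2` and `-2n`
  have hpos : ∃ v : Fin 5 → ℚ, 0 < Matrix.toBilin' A v v := by
    refine ⟨fun i => Sum.elim (fun i' => b.repr 1 i') (fun _ => 0) (e.symm i), ?_⟩
    rw [hAval]
    simp only [Equiv.symm_apply_apply, Sum.elim_inl, Sum.elim_inr]
    rw [b.sum_repr 1, reducedNorm_one]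
    norm_num
  have hneg : ∃ w : Fin 5 → ℚ, Matrix.toBilin' A w w < 0 := by
    rcases hsign with hpos' | ⟨xn, hxn⟩
    · refine ⟨fun i => Sum.elim (fun _ => 0) (fun _ => 1) (e.symm i), ?_⟩
      rw [hAval]
      simp only [Equiv.symm_apply_apply, Sum.elim_inl, Sum.elim_inr, zero_smul,
        Finset.sum_const_zero, reducedNorm_apply_zero, mul_zero, zero_add, one_pow, mul_one]
      linarith
    · refine ⟨fun i => Sum.elim (fun i' => b.repr xn i') (fun _ => 0) (e.symm i), ?_⟩
      rw [hAval]
      simp only [Equiv.symm_apply_apply, Sum.elim_inl, Sum.elim_inr]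
      rw [b.sum_repr xn]
      nlinarith
  -- Meyer
  obtain ⟨v, hv0, hv⟩ :=
    Literature.NumberTheory.QuadraticForms.meyer_holds A le_rfl hAsymm hAdet hpos hneg
  rw [hAval] at hv
  set x : B := ∑ i', v (e (Sum.inl i')) • b i' with hx
  set t : ℚ := v (e (Sum.inr 0)) with ht
  have hxt : reducedNorm ℚ B x = n * t ^ 2 := by linarith
  have ht0 : t ≠ 0 := by
    intro ht0
    have hnx : reducedNorm ℚ B x = 0 := by rw [hxt, ht0]; ring
    -- then `x = 0`, so `v = 0`
    have hx0 : x = 0 := by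
      by_contra hx0
      exact ((isUnit_iff_reducedNorm_ne_zero_holds ℚ B x).mp (hdiv x hx0)) hnx
    apply hv0
    have hcoef : ∀ i', v (e (Sum.inl i')) = 0 :=
      (Fintype.linearIndependent_iff.mp b.linearIndependent) (fun i' => v (e (Sum.inl i')))
        (by rw [← hx]; exact hx0)
    funext i
    obtain ⟨s, rfl⟩ := e.surjective i
    rcases s with i' | j
    · exact hcoef i'
    · have hj : j = 0 := Subsingleton.elim _ _
      subst hj
      exact ht0
  refine ⟨t⁻¹ • x, ?_⟩
  rw [reducedNorm_smul, hxt, inv_pow]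
  field_simp

/-- **Every positive rational is a reduced norm** (Vignéras III §4 Thm. 4.1 for `K = ℚ`,
`n > 0`): in a division quaternion algebra `B` over `ℚ`, `nrd(x) = n` is solvable for every
rational `n > 0` (Meyer's theorem for the quinary form `2 nrd(x) - 2 n t²`).
[cite: VignerasLNM800, Ch. III §4 Thm. 4.1] -/
theorem exists_reducedNorm_eq_of_pos (hdiv : ∀ x : B, x ≠ 0 → IsUnit x) {n : ℚ} (hn : 0 < n) :
    ∃ x : B, reducedNorm ℚ B x = n :=
  exists_reducedNorm_eq_of_pos_or_exists_neg hdiv hn.ne' (Or.inl hn)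

/-- **Every non-zero rational is a reduced norm from an indefinite division quaternion algebra over
`ℚ`** (Vignéras III §4 Thm. 4.1 for `K = ℚ`, no ramified real place): if `nrd` takes a negative
value on `B` then `nrd(x) = n` is solvable for every rational `n ≠ 0`.
[cite: VignerasLNM800, Ch. III §4 Thm. 4.1] -/
theorem exists_reducedNorm_eq_of_exists_neg (hdiv : ∀ x : B, x ≠ 0 → IsUnit x)
    (hneg : ∃ x : B, reducedNorm ℚ B x < 0) {n : ℚ} (hn : n ≠ 0) :
    ∃ x : B, reducedNorm ℚ B x = n :=
  exists_reducedNorm_eq_of_pos_or_exists_neg hdiv hn (Or.inr hneg)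

end Literature.NumberTheory.Automorphic
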